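import Mathlib.AlgebraicTopology.FundamentalGroupoid.FundamentalGroup
import Mathlib.AlgebraicTopology.FundamentalGroupoid.Basic
import Mathlib.Algebra.Category.ModuleCat.Basic
import Mathlib.Algebra.Category.ModuleCat.ChangeOfRings
import Mathlib.CategoryTheory.Endomorphism
import Mathlib.RepresentationTheory.Invariants
import Mathlib.LinearAlgebra.Dimension.Finrank
import Mathlib.AlgebraicTopology.FundamentalGroupoid.SimplyConnected
import HarnessLib

-- provenance: harness21/H21/H21/Prelude/MotiveL/LocalSystems.lean @ 46c1cf4 (interim HEAD d8f2665); M5 mechanical rewrite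
/-!
# Local systems (trunk MotiveL, prelude)

An honest, Mathlib-only formalisation of local systems of `R`-modules on a topological
space `S`, in the "representation of the fundamental groupoid" incarnation:
a local system is a functor `Π₁(S) ⥤ ModuleCat R` (Deligne, *Équations différentielles à
points singuliers réguliers* (1970), I.1, esp. Cor. 1.4; Voisin, *Hodge Theory and Complex
Algebraic Geometry I*, §9.2 (local systems and monodromy); on a locally simply connected
space this is equivalent to locally constant sheaves).

## Contents
* `Literature.LocalSystem R S`: the type of local systems (an `abbrev` for a functor category, so
  morphisms / isomorphisms of local systems are natural transformations / isomorphisms).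
* `LocalSystem.fiber`, `LocalSystem.transport` (parallel transport along a homotopy class of
  paths), `transport_refl`, `transport_trans`.
* `LocalSystem.monodromy`, `LocalSystem.monodromyRep`: the monodromy representation
  `π₁(S, s) →* End(V_s)` (via Mathlib's `CategoryTheory.Functor.mapEnd` and
  `ModuleCat.endRingEquiv`).
* `LocalSystem.flatSections` (global sections = families of vectors compatible with all
  transports), `flatSectionsEval`, `flatSectionsEval_injective`,
  `range_flatSectionsEval_eq_invariants` (global sections = monodromy invariants on a
  path-connected base; Voisin I, Cor. 9.2.3 area / Deligne I.1.4).
* Constructions: `LocalSystem.const`, `IsTrivial`, `comap` (pullback along a continuous map,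
  via Mathlib's `FundamentalGroupoid.map`), `baseChange` (via `ModuleCat.extendScalars`),
  `rank`, `rank_eq_of_joined`.

## Mathlib search
Mathlib has no `LocalSystem` / locally-constant-sheaf-of-modules notion (grep for
`local.?system` finds nothing relevant); it does have all the ingredients used here:
`FundamentalGroupoid`, `FundamentalGroup = End (FundamentalGroupoid.mk x)`,
`FundamentalGroupoid.map`, `FundamentalGroupoid.fromPath`, `Functor.mapEnd`,
`ModuleCat.endRingEquiv`, `ModuleCat.extendScalars`, `Representation.invariants`.

## Design notes
* Universe discipline: `R S : Type u` and fibres in `ModuleCat.{u} R`, as fixed by the outline.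
* Composition convention: in Mathlib `FundamentalGroup.mul_def : p * q = q.trans p`, and
  `End`-multiplication in `ModuleCat` is composition of linear maps, so `monodromyRep` is a
  genuine monoid hom with `monodromyRep V s (p * q) = monodromyRep V s p ∘ₗ monodromyRep V s q`.
* `Representation` and `ModuleCat.extendScalars` need a commutative coefficient ring, so
  `range_flatSectionsEval_eq_invariants` and `baseChange` live in `CommRing` sections; the rest
  only assumes `Ring R`.
-/

open CategoryTheory

universe u

namespace Literature.AlgebraicGeometry.Motives

/-- A **local system** of `R`-modules on a topological space `S`: a functor from the
fundamental groupoid of `S` to `R`-modules (Deligne 1970, I.1; Voisin, *Hodge Theory I*,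
§9.2). Morphisms of local systems are natural transformations. [cite: Deligne1970, I.1] -/
abbrev LocalSystem (R : Type u) [Ring R] (S : Type u) [TopologicalSpace S] : Type (u + 1) :=
  FundamentalGroupoid S ⥤ ModuleCat.{u} R

namespace LocalSystem

section Ring

variable {R : Type u} [Ring R] {S : Type u} [TopologicalSpace S] (V : LocalSystem R S)

/-- The fibre (stalk) `V_s` of a local system at a point `s : S` (Voisin I, §9.2). [folklore] -/
abbrev fiber (s : S) : ModuleCat.{u} R := V.obj ⟨s⟩

/-- Parallel transport `V_s →ₗ[R] V_t` along a homotopy class of paths from `s` to `t`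
(Deligne 1970, I.1.1; Voisin I, §9.2). [cite: Deligne1970, I.1.1] -/
noncomputable def transport {s t : S} (γ : Path.Homotopic.Quotient s t) :
    V.fiber s →ₗ[R] V.fiber t :=
  (V.map (FundamentalGroupoid.fromPath γ)).hom

/-- Parallel transport along the constant path is the identity (functoriality;
Deligne 1970, I.1.1). [cite: Deligne1970, I.1.1] -/
@[simp]
theorem transport_refl (s : S) :
    V.transport (Path.Homotopic.Quotient.refl s) = LinearMap.id := by
  change (V.map (𝟙 (FundamentalGroupoid.mk s))).hom = _
  rw [V.map_id]
  rfl

/-- Parallel transport is compatible with concatenation of paths (functoriality;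
Deligne 1970, I.1.1). [cite: Deligne1970, I.1.1] -/
theorem transport_trans {s t w : S} (γ : Path.Homotopic.Quotient s t)
    (δ : Path.Homotopic.Quotient t w) :
    V.transport (γ.trans δ) = V.transport δ ∘ₗ V.transport γ := by
  change (V.map (FundamentalGroupoid.fromPath γ ≫ FundamentalGroupoid.fromPath δ)).hom = _
  rw [V.map_comp]
  rfl

/-- The **monodromy** of a local system at `s`: the action of the fundamental group
`π₁(S, s)` on the fibre `V_s` by categorical endomorphisms (Voisin I, §9.2, "monodromy
representation"; Deligne 1970, I.1.4). This is Mathlib's `Functor.mapEnd`. [cite: Deligne1970, I.1.4] -/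
noncomputable def monodromy (s : S) : FundamentalGroup S s →* End (V.fiber s) :=
  V.mapEnd (FundamentalGroupoid.mk s)

/-- The **monodromy representation** `π₁(S, s) →* End_R(V_s)` of a local system at `s`, as a
monoid hom to linear endomorphisms (Voisin I, Cor. 9.2.4; Deligne 1970, I.1.4). When `R` is
commutative this is literally a `Representation R (FundamentalGroup S s) (V.fiber s)`. [cite: Deligne1970, I.1.4] -/
noncomputable def monodromyRep (s : S) : FundamentalGroup S s →* (V.fiber s →ₗ[R] V.fiber s) :=
  (ModuleCat.endRingEquiv (V.fiber s)).toMonoidHom.comp (V.monodromy s)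

/-- The monodromy of a loop is parallel transport along it (Voisin I, §9.2). [folklore] -/
theorem monodromyRep_apply (s : S) (γ : FundamentalGroup S s) :
    V.monodromyRep s γ = V.transport (FundamentalGroup.toPath γ) := rfl

/-- The `R`-module of **flat (global) sections** of a local system: families of vectors
`v s ∈ V_s` compatible with every parallel transport, i.e. `Γ(S, V)` (Voisin I, §9.2;
Deligne 1970, I.1). [cite: Deligne1970, I.1] -/
def flatSections : Submodule R (∀ s : S, V.fiber s) where
  carrier := {v | ∀ (s t : S) (γ : Path.Homotopic.Quotient s t), V.transport γ (v s) = v t}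
  add_mem' := by intro a b ha hb s t γ; simp [ha s t γ, hb s t γ]
  zero_mem' := by intro s t γ; simp
  smul_mem' := by intro c a ha s t γ; simp [ha s t γ]

/-- Membership in `flatSections`, unfolded. [folklore] -/
theorem mem_flatSections_iff (v : ∀ s : S, V.fiber s) :
    v ∈ V.flatSections ↔
      ∀ (s t : S) (γ : Path.Homotopic.Quotient s t), V.transport γ (v s) = v t :=
  Iff.rfl

/-- Evaluation of flat sections at a point `s`: the restriction map `Γ(S, V) → V_s`
(Voisin I, §9.2). [folklore] -/
def flatSectionsEval (s : S) : V.flatSections →ₗ[R] V.fiber s :=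
  (LinearMap.proj s).comp V.flatSections.subtype

/-- `flatSectionsEval` is evaluation. [folklore] -/
@[simp]
theorem flatSectionsEval_apply (s : S) (v : V.flatSections) :
    V.flatSectionsEval s v = (v : ∀ t : S, V.fiber t) s := rfl

/-- On a path-connected base a flat section is determined by its value at one point
(Voisin I, §9.2; Deligne 1970, I.1.4). [cite: Deligne1970, I.1.4] -/
theorem flatSectionsEval_injective [PathConnectedSpace S] (s : S) :
    Function.Injective (V.flatSectionsEval s) := by
  intro v w h
  apply Subtype.ext
  funext t
  have hv := v.2 s t ⟦PathConnectedSpace.somePath s t⟧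
  have hw := w.2 s t ⟦PathConnectedSpace.somePath s t⟧
  simp only [flatSectionsEval_apply] at h
  rw [← hv, ← hw, h]

end Ring

section CommRing

variable {R : Type u} [CommRing R] {S : Type u} [TopologicalSpace S] (V : LocalSystem R S)

/-- **Global sections are monodromy invariants.** On a path-connected base, evaluation at
`s` identifies the flat sections `Γ(S, V)` with the invariants `V_s^{π₁(S,s)}` of the
monodromy representation (Voisin, *Hodge Theory I*, §9.2 (cf. Cor. 9.2.4 ff.);
Deligne 1970, Cor. I.1.4). Together with `flatSectionsEval_injective` this gives
`Γ(S, V) ≃ₗ[R] V_s^{π₁}`. [cite: Deligne1970, Cor. I.1.4] -/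
def range_flatSectionsEval_eq_invariants : Prop :=
  ∀ [PathConnectedSpace S] (s : S),
    LinearMap.range (V.flatSectionsEval s) =
      Representation.invariants (V.monodromyRep s)

end CommRing

/-! ### Constructions -/

section Constructions

variable {R : Type u} [Ring R] {S : Type u} [TopologicalSpace S]

variable (R S) in
/-- The **constant** (trivial) local system with fibre `M`: every transport is the identity
(Voisin I, §9.2; Deligne 1970, I.1). [cite: Deligne1970, I.1] -/
noncomputable def const (M : ModuleCat.{u} R) : LocalSystem R S :=
  (Functor.const (FundamentalGroupoid S)).obj M

/-- The fibre of the constant local system is definitionally `M`. [folklore] -/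
@[simp]
theorem const_fiber (M : ModuleCat.{u} R) (s : S) : (const R S M).fiber s = M := rfl

/-- Transport in the constant local system is the identity. [folklore] -/
@[simp]
theorem const_transport (M : ModuleCat.{u} R) {s t : S} (γ : Path.Homotopic.Quotient s t) :
    (const R S M).transport γ = LinearMap.id := rfl

/-- A local system is **trivial** if it is isomorphic to a constant one
(Voisin I, §9.2; Deligne 1970, I.1). [cite: Deligne1970, I.1] -/
def IsTrivial (V : LocalSystem R S) : Prop :=
  ∃ M : ModuleCat.{u} R, Nonempty (V ≅ const R S M)

/-- Constant local systems are trivial. [folklore] -/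
theorem isTrivial_const (M : ModuleCat.{u} R) : (const R S M).IsTrivial :=
  ⟨M, ⟨Iso.refl _⟩⟩

/-- On a simply connected space every local system is trivial (Voisin I, §9.2;
Deligne 1970, I.1: `Π₁(S)` is then equivalent to the point). [cite: Deligne1970, I.1:  Π₁(S] -/
def isTrivial_of_simplyConnectedSpace : Prop :=
  ∀ [SimplyConnectedSpace S] (V : LocalSystem R S),
    V.IsTrivial

/-- **Pullback** (inverse image) `f⁻¹ V` of a local system along a continuous map
`f : S' → S`, i.e. precomposition with `Π₁(f)` (Deligne 1970, I.1; Voisin I, §9.2). Uses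
Mathlib's `FundamentalGroupoid.map`. [cite: Deligne1970, I.1] -/
noncomputable def comap {S' : Type u} [TopologicalSpace S'] (f : C(S', S)) (V : LocalSystem R S) :
    LocalSystem R S' :=
  FundamentalGroupoid.map f ⋙ V

/-- The fibre of the pullback at `s'` is the fibre at `f s'`. [folklore] -/
@[simp]
theorem comap_fiber {S' : Type u} [TopologicalSpace S'] (f : C(S', S)) (V : LocalSystem R S)
    (s' : S') : (V.comap f).fiber s' = V.fiber (f s') := rfl

/-- Transport in the pullback is transport along the image path. [folklore] -/
theorem comap_transport {S' : Type u} [TopologicalSpace S'] (f : C(S', S)) (V : LocalSystem R S)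
    {s' t' : S'} (γ : Path.Homotopic.Quotient s' t') :
    (V.comap f).transport γ = V.transport (γ.map f) := rfl

/-- The **rank** of a local system at `s`: the `finrank` of the fibre `V_s` (junk value `0`
if the fibre is not finite free). On a path-connected base it is independent of `s`
(`rank_eq_of_joined`). (Voisin I, §9.2.) [folklore] -/
noncomputable def rank (V : LocalSystem R S) (s : S) : ℕ :=
  Module.finrank R (V.fiber s)

/-- Parallel transport is a linear equivalence `V_s ≃ₗ[R] V_t` (all morphisms of `Π₁(S)` are
invertible; Deligne 1970, I.1.1). [cite: Deligne1970, I.1.1] -/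
noncomputable def transportEquiv (V : LocalSystem R S) {s t : S}
    (γ : Path.Homotopic.Quotient s t) : V.fiber s ≃ₗ[R] V.fiber t :=
  (V.mapIso (Groupoid.isoEquivHom _ _ |>.symm (FundamentalGroupoid.fromPath γ))).toLinearEquiv

/-- The underlying linear map of `transportEquiv` is `transport`. [folklore] -/
@[simp]
theorem coe_transportEquiv (V : LocalSystem R S) {s t : S} (γ : Path.Homotopic.Quotient s t) :
    (V.transportEquiv γ : V.fiber s →ₗ[R] V.fiber t) = V.transport γ := rfl

/-- The rank of a local system is constant along path components (Voisin I, §9.2). [folklore] -/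
theorem rank_eq_of_joined (V : LocalSystem R S) {s t : S} (h : Joined s t) :
    V.rank s = V.rank t := by
  obtain ⟨γ⟩ := h
  exact (V.transportEquiv ⟦γ⟧).finrank_eq

end Constructions

section BaseChange

variable {R : Type u} [CommRing R] {R' : Type u} [CommRing R'] {S : Type u} [TopologicalSpace S]

/-- **Extension of scalars** `V ⊗_R R'` of a local system along a ring hom `f : R →+* R'`,
fibrewise `ModuleCat.extendScalars f` (e.g. `V_ℤ ↦ V_ℚ = V_ℤ ⊗ ℚ`; Deligne 1970, I.1;
Voisin I, §9.2). [cite: Deligne1970, I.1] -/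
noncomputable def baseChange (f : R →+* R') (V : LocalSystem R S) : LocalSystem R' S :=
  V ⋙ ModuleCat.extendScalars f

/-- The fibre of the base change is the base change of the fibre. [folklore] -/
@[simp]
theorem baseChange_fiber (f : R →+* R') (V : LocalSystem R S) (s : S) :
    (V.baseChange f).fiber s = (ModuleCat.extendScalars f).obj (V.fiber s) := rfl

end BaseChange

end LocalSystem

end Literature.AlgebraicGeometry.Motives
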